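import Summits.QuantumFields.BalabanUV.Beta.D1BFx.TorusTwoArrayWords
import Summits.QuantumFields.BalabanUV.Beta.D1BFx.TorusWeightWordArrays
import Summits.QuantumFields.BalabanUV.Beta.D1BFx.TorusGhostPairArrays

/-!
# TB4-W PART 3b-N (FILE N3b) — the site-word and bond LETTERS of the mixed straight weight jet (road «BF-x», slot (K); ruling ρ-g7-8, shape (S1))

The monomials of 3a's `2•wgtMix b b′` (nine terms in `Mjet•`, `Ĉ`, `Ĉ•`) are of four kinds: `D̂·S·D̂ᵀ`, `D̂·S·Ê_b′ᵀ`, `Ê_b·S·D̂ᵀ`, `Ê_b·S·Ê_b′ᵀ`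
with SITE WORDS `S` = products of the legs `L̂ = perT lapU`, `Ĉ = perT Cgh` and of the bond arrays `Ljet = perT (arr ghCur)`,
`(L̂²)• = perT (arr Lgh)`, `Ljet₂ = perT (arr gh₂)`.  This file turns every site word that occurs into `perT (arr Z)` for an explicit
(`s`-dependent where two arrays meet through a leg) `ℤ⁴` kernel `Z`, and supplies the generic bond conversions with an ARRAY middle
(`D̂·perT(arr Z)·Ê_b′ᵀ`, `Ê_b·perT(arr Z)·D̂ᵀ` — 3b-β FILE 2 at `Y := arr s Z`).  The assembly is FILE N3c.
[folklore] matrix∕array algebra over landed names; no definitions.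
-/

noncomputable section

namespace Summit.QuantumFields.BalabanUV.Beta.D1BFx.TorusMixedLetters

open Matrix
open scoped BigOperators
open Literature.MathematicalPhysics.QuantumFieldTheory.Balaban1983to89
open Literature.MathematicalPhysics.QuantumFieldTheory.Balaban1983to89.Beta
open B12Sec2to5 (l1 l1_nonneg)
open ExpKernelCalculus (MKer BiLoc Decays Zl comp shiftK biLoc_comp_decays)
open AffineAveraging (unitVec)
open BalabanStepJetsSucc (biLoc_comp_right decays_comp)
open Summit.QuantumFields.BalabanUV.Beta.TameKernelCalculus (Loc decays_of_le biLoc_of_le trK)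
open Summit.QuantumFields.BalabanUV.Beta.D1BFx.PeriodicArrays (arr toF isPeriodic₂_arr rowBound_arr decays_arr shiftK_arr summable_arr_term arr_trK)
open Summit.QuantumFields.BalabanUV.Beta.D1BFx.FibredPeriodisation (periodiseF periodiseF_apply)
open Summit.QuantumFields.BalabanUV.Beta.D1BFx.GhostStencil (ghCur biLoc_ghCur)
open Summit.QuantumFields.BalabanUV.Beta.D1BFx.RJetProjector (Rgt decays_Rgt)
open Summit.QuantumFields.BalabanUV.Beta.D1BFx.PeriodisedProjector (Lhat Shat)
open Summit.QuantumFields.BalabanUV.Beta.D1BFx.TorusHodgeWeight (Dhat)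
open Summit.QuantumFields.BalabanUV.Beta.D1BFx.TorusCoframeJets (Djet Ljet Ljet₂ Ljet₁₁)
open Summit.QuantumFields.BalabanUV.Beta.D1BFx.TorusJetSandwichArrays (jetR jetC Djet_mul_Yhat_mul_Dhat_transpose Dhat_mul_Yhat_mul_Djet_transpose)
open Summit.QuantumFields.BalabanUV.Beta.D1BFx.TorusGhostWordArrays (perT lapU decays_lapU lapU_imageShift Lgh biLoc_Lgh cL Ljet_eq_perT Lhat_eq_perT
  perT_mul_perT_arr perT_arr_mul_perT)
open Summit.QuantumFields.BalabanUV.Beta.D1BFx.TorusGhostPairStencils (gh₂ biLoc_gh₂ perT_arr_mul_perT_arr)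
open Summit.QuantumFields.BalabanUV.Beta.D1BFx.TorusGhostPairArrays (Ljet₂_eq_perT)
open Summit.QuantumFields.BalabanUV.Beta.D1BFx.KGhostLeg (Cgh deltaCgh deltaCgh_pos decays_Cgh isPeriodic₂_Cgh)
open Summit.QuantumFields.BalabanUV.Beta.D1BFx.TorusBondArrays (hat_arr_add hat_arr_sub hat_arr_neg hat_arr_smul perT_eq_periodise₂ dB dB_pos dB_le_one
  dB_le_deltaCgh decays_lapU_Cgh decays_Cgh_lapU lapU_Cgh_imageShift Cgh_lapU_imageShift shiftK_Cgh_mul Rhat_eq_perT Lhat_Chat_Lhat_eq_perT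
  Lhat_mul_perT_Cgh perT_Cgh_mul_Lhat)
open Summit.QuantumFields.BalabanUV.Beta.D1BFx.TorusWeightWordArrays (wL wR wC Ljet_Cgh_Lhat Lhat_Cgh_Ljet Lhat_Cgh_Lsq_Cgh_Lhat shiftK_Rgt_mul)
open Summit.QuantumFields.BalabanUV.Beta.D1BFx.TorusTwoArrayWords (biLoc_comp_arr perT_arr_leg_arr)

variable (s : ℕ) [NeZero s]

/-! ## §1 Array linearity in `Loc` currency; transposes; tests -/

section Linear

variable {F : Type*} {V W : MKer 4 F}

/-- [folklore] `(arr (V + W))^ = (arr V)^ + (arr W)^` for LOCALISED `V`, `W` (TA2 linearity, `Loc` currency). -/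
theorem hat_arr_add_loc (hV : Loc V) (hW : Loc W) :
    Matrix.of (periodiseF s (toF (arr s (V + W)))) = Matrix.of (periodiseF s (toF (arr s V))) + Matrix.of (periodiseF s (toF (arr s W))) := by
  obtain ⟨_, _, _, _, hδ, hV⟩ := hV
  obtain ⟨_, _, _, _, hδ', hW⟩ := hW
  exact hat_arr_add s hV hδ hW hδ'

/-- [folklore] `(arr (V − W))^ = (arr V)^ − (arr W)^` for localised `V`, `W`. -/
theorem hat_arr_sub_loc (hV : Loc V) (hW : Loc W) :
    Matrix.of (periodiseF s (toF (arr s (V - W)))) = Matrix.of (periodiseF s (toF (arr s V))) - Matrix.of (periodiseF s (toF (arr s W))) := by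
  obtain ⟨_, _, _, _, hδ, hV⟩ := hV
  obtain ⟨_, _, _, _, hδ', hW⟩ := hW
  exact hat_arr_sub s hV hδ hW hδ'

/-- [folklore] `(arr 0)^ = 0`. -/
theorem hat_arr_zero : Matrix.of (periodiseF s (toF (arr s (0 : MKer 4 F)))) = 0 := by
  have h := hat_arr_smul s (0 : ℝ) (0 : MKer 4 F)
  rwa [zero_smul, zero_smul] at h

/-- [folklore] The array of a tested family: `(arr (if P then K else 0))^ = if P then (arr K)^ else 0`. -/
theorem hat_arr_ite (P : Prop) [Decidable P] (K : MKer 4 F) :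
    Matrix.of (periodiseF s (toF (arr s (if P then K else 0)))) = if P then Matrix.of (periodiseF s (toF (arr s K))) else 0 := by
  split_ifs
  · rfl
  · exact hat_arr_zero s

/-- [folklore] **TRANSPOSE OF AN ARRAY**: `((arr K)^)ᵀ = (arr (trK K))^` (`SortedKernels.periodiseF_trF`, `arr_trK`). -/
theorem transpose_hat_arr (K : MKer 4 F) :
    (Matrix.of (periodiseF s (toF (arr s K))))ᵀ = Matrix.of (periodiseF s (toF (arr s (trK K)))) := by
  rw [← SortedKernels.periodiseF_trF (fun a b => isPeriodic₂_arr s K a b)]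
  rfl

end Linear

/-! ## §2 Bond conversions with an array in the middle -/

section Bond

variable {Z : MKer 4 Unit} {p q : Fin 4 → ℤ} {C δ : ℝ} (κ : Fin 4) (u : Fin 4 → ℤ)

/-- [folklore] **`Ê_b · perT (arr Z) · D̂ᵀ = (arr (jetR κ u (arr s Z)))^`** (3b-β FILE 2 at the s-uniformly decaying, jointly periodic leg `Y := arr s Z`). -/
theorem Djet_perT_arr_Dhat_transpose (hZ : BiLoc Z p q C δ) (hδ : 0 < δ) :
    Djet s (siteOf 4 s u, κ) * perT s (arr s Z) * (Dhat 4 s)ᵀ = Matrix.of (periodiseF s (toF (arr s (jetR κ u (arr s Z))))) := by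
  rw [perT_eq_periodise₂]
  exact Djet_mul_Yhat_mul_Dhat_transpose s κ u (decays_arr hZ hδ s) (half_pos hδ) (shiftK_arr s Z)

/-- [folklore] **`D̂ · perT (arr Z) · Ê_bᵀ = (arr (jetC κ u (arr s Z)))^`**. -/
theorem Dhat_perT_arr_Djet_transpose (hZ : BiLoc Z p q C δ) (hδ : 0 < δ) :
    Dhat 4 s * perT s (arr s Z) * (Djet s (siteOf 4 s u, κ))ᵀ = Matrix.of (periodiseF s (toF (arr s (jetC κ u (arr s Z))))) := by
  rw [perT_eq_periodise₂]
  exact Dhat_mul_Yhat_mul_Djet_transpose s κ u (decays_arr hZ hδ s) (half_pos hδ) (shiftK_arr s Z)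

end Bond

/-! ## §3 The site words of `2•wgtMix` as `perT (arr Z)` -/

section Site

variable (m : ℕ) {a : ℝ} (p : ℕ) [NeZero p] (κ : Fin 4) (u : Fin 4 → ℤ) (l : Fin 4) (u' : Fin 4 → ℤ)

/-- [folklore] `Cgh (m+1) a` decays at the common leg rate `dB/2` (constant made explicit through `decays_of_le`). -/
theorem decays_Cgh_dB (ha : 0 < a) : ∃ C : ℝ, Decays (Cgh (m + 1) a) C (dB (m + 1) a / 2) := by
  obtain ⟨C, hC⟩ := decays_Cgh (m + 1) a ha
  exact ⟨_, decays_of_le hC (by linarith [dB_le_deltaCgh (m + 1) a, dB_pos (m + 1) a ha])⟩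

/-- [folklore] **S1: `Ljet_b · perT Cgh · Ljet_b′ = perT (arr (ghCur_β ∘ Cgh ∘ arr s ghCur_β′))`** (two arrays through the ghost leg). -/
theorem Ljet_Cgh_Ljet (ha : 0 < a) :
    Ljet ((m + 1) * p) (siteOf 4 ((m + 1) * p) u, κ) * perT ((m + 1) * p) (Cgh (m + 1) a) * Ljet ((m + 1) * p) (siteOf 4 ((m + 1) * p) u', l)
      = perT ((m + 1) * p) (arr ((m + 1) * p)
          (comp (comp (ghCur κ u) (Cgh (m + 1) a)) (arr ((m + 1) * p) (ghCur l u')))) := by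
  obtain ⟨C, hC⟩ := decays_Cgh_dB m ha
  have hd := dB_pos (m + 1) a ha
  rw [Ljet_eq_perT, Ljet_eq_perT,
    perT_arr_leg_arr _ (biLoc_ghCur κ u (dB (m + 1) a / 2)) hC (fun x y t v w => KGhostLeg.Cgh_imageShift (m + 1) a ha ⟨p, rfl⟩ x y t v w) (biLoc_ghCur l u' (dB (m + 1) a / 2)) (half_pos hd)]

/-- [folklore] **S4: `L̂ · perT Cgh · Ljet₁₁ b b′ = [b = b′]·perT (arr ((lapU ∘ Cgh) ∘ gh₂_β))`** (the TORUS test `b = b′` is kept as stated). -/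
theorem Lhat_Cgh_Ljet₁₁ (ha : 0 < a) :
    Lhat ((m + 1) * p) * perT ((m + 1) * p) (Cgh (m + 1) a)
        * Ljet₁₁ ((m + 1) * p) (siteOf 4 ((m + 1) * p) u, κ) (siteOf 4 ((m + 1) * p) u', l)
      = if (siteOf 4 ((m + 1) * p) u, κ) = (siteOf 4 ((m + 1) * p) u', l) then
          perT ((m + 1) * p) (arr ((m + 1) * p) (comp (comp lapU (Cgh (m + 1) a)) (gh₂ κ u))) else 0 := by
  obtain ⟨C, hC⟩ := decays_lapU_Cgh (m + 1) a ha
  have hd := dB_pos (m + 1) a ha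
  rw [Ljet₁₁]
  split_ifs with h
  · rw [Ljet₂_eq_perT, Lhat_mul_perT_Cgh a m p ha,
      perT_mul_perT_arr _ hC (half_pos hd) (lapU_Cgh_imageShift (m + 1) a ha p) (biLoc_gh₂ κ u 1) one_pos]
  · rw [Matrix.mul_zero]

/-- [folklore] **S5: `(L̂·perT Cgh) · (L̂²)_b · perT Cgh · Ljet_b′ = perT (arr (((lapU∘Cgh) ∘ Lgh_β) ∘ Cgh ∘ arr s ghCur_β′))`**. -/
theorem Lhat_Cgh_Lsq_Cgh_Ljet (ha : 0 < a) :
    Lhat ((m + 1) * p) * perT ((m + 1) * p) (Cgh (m + 1) a)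
        * (Ljet ((m + 1) * p) (siteOf 4 ((m + 1) * p) u, κ) * Lhat ((m + 1) * p)
            + Lhat ((m + 1) * p) * Ljet ((m + 1) * p) (siteOf 4 ((m + 1) * p) u, κ))
        * perT ((m + 1) * p) (Cgh (m + 1) a) * Ljet ((m + 1) * p) (siteOf 4 ((m + 1) * p) u', l)
      = perT ((m + 1) * p) (arr ((m + 1) * p)
          (comp (comp (comp (comp lapU (Cgh (m + 1) a)) (Lgh κ u)) (Cgh (m + 1) a)) (arr ((m + 1) * p) (ghCur l u')))) := by
  obtain ⟨C₁, hC₁⟩ := decays_lapU_Cgh (m + 1) a ha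
  obtain ⟨C, hC⟩ := decays_Cgh_dB m ha
  obtain ⟨C₃, -, hC₃⟩ := TorusWeightWordArrays.biLoc_lapU_Cgh_Lgh m ha
  have hd := dB_pos (m + 1) a ha
  have hX : BiLoc (comp (comp lapU (Cgh (m + 1) a)) (Lgh κ u)) u u C₃ (dB (m + 1) a / 4) := hC₃ κ u
  rw [Lhat_mul_perT_Cgh a m p ha, TorusGhostWordArrays.Lsq_word_eq_perT, Ljet_eq_perT,
    perT_mul_perT_arr _ hC₁ (half_pos hd) (lapU_Cgh_imageShift (m + 1) a ha p) (biLoc_Lgh κ u) (by norm_num),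
    perT_arr_leg_arr _ hX (decays_of_le hC (by linarith)) (fun x y t v w => KGhostLeg.Cgh_imageShift (m + 1) a ha ⟨p, rfl⟩ x y t v w) (biLoc_ghCur l u' (dB (m + 1) a / 4)) (by linarith)]

/-- [folklore] **LEG × LEG**: `perT A · perT B = perT (A ∘ B)` for decaying legs with `B` jointly periodic (`KGhostLeg.periodiseF_toF_comp` re-indexed). -/
theorem perT_mul_perT_leg {A B : MKer 4 Unit} {CA CB δA δB : ℝ} (hA : Decays A CA δA) (hδA : 0 < δA) (hB : Decays B CB δB) (hδB : 0 < δB)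
    (hBper : ∀ v w : Unit, IsPeriodic₂ s (FibredPeriodisation.Kfib (toF B) v w)) : perT s A * perT s B = perT s (comp A B) := by
  rw [perT, perT, perT, TorusGhostWordArrays.submatrix_unit_mul, ← KGhostLeg.periodiseF_toF_comp hA hδA hB hδB hBper]

/-- [folklore] The leg `A₃ := lapU ∘ (Cgh ∘ lapU)`: `L̂ · perT (Cgh ∘ lapU) = perT A₃`, with decay and joint periodicity letters. -/
theorem Lhat_mul_perT_A₂ (ha : 0 < a) :
    Lhat ((m + 1) * p) * perT ((m + 1) * p) (comp (Cgh (m + 1) a) lapU) = perT ((m + 1) * p) (comp lapU (comp (Cgh (m + 1) a) lapU)) := by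
  obtain ⟨C, hC⟩ := decays_Cgh_lapU (m + 1) a ha
  rw [Lhat_eq_perT, perT_mul_perT_leg _ decays_lapU one_pos hC (half_pos (dB_pos (m + 1) a ha))
    (fun v w x y t => Cgh_lapU_imageShift (m + 1) a ha p x y t v w)]

/-- [folklore] Decay of `A₃ = lapU ∘ (Cgh ∘ lapU)` at the rate `dB/4`. -/
theorem decays_A₃ (ha : 0 < a) : ∃ C : ℝ, Decays (comp lapU (comp (Cgh (m + 1) a) lapU)) C (dB (m + 1) a / 4) := by
  obtain ⟨C, hC⟩ := decays_Cgh_lapU (m + 1) a ha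
  have hd := dB_pos (m + 1) a ha
  exact ⟨_, decays_comp (decays_of_le decays_lapU (by linarith [dB_le_one (m + 1) a])) hC (by linarith) (by linarith)⟩

omit [NeZero p] in
/-- [folklore] Joint periodicity of `A₃`. -/
theorem A₃_imageShift (ha : 0 < a) (x y t : Fin 4 → ℤ) (v w : Unit) :
    comp lapU (comp (Cgh (m + 1) a) lapU) (imageShift ((m + 1) * p) x t) (imageShift ((m + 1) * p) y t) v w = comp lapU (comp (Cgh (m + 1) a) lapU) x y v w := by
  refine PeriodicArrays.periodic_of_shiftK (fun t' => ?_) x y t v w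
  rw [← ExpKernelCalculus.comp_shiftK, TorusGhostWordArrays.shiftK_lapU, TorusBondArrays.shiftK_Cgh_lapU (m + 1) a ha p t']

/-- [folklore] The leg `A₄ := (lapU ∘ Cgh) ∘ lapU`: `(L̂ · perT Cgh) · L̂ = perT A₄`. -/
theorem Lhat_perT_Cgh_Lhat (ha : 0 < a) :
    Lhat ((m + 1) * p) * perT ((m + 1) * p) (Cgh (m + 1) a) * Lhat ((m + 1) * p) = perT ((m + 1) * p) (comp (comp lapU (Cgh (m + 1) a)) lapU) := by
  obtain ⟨C, hC⟩ := decays_lapU_Cgh (m + 1) a ha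
  rw [Lhat_mul_perT_Cgh a m p ha, Lhat_eq_perT,
    perT_mul_perT_leg _ hC (half_pos (dB_pos (m + 1) a ha)) decays_lapU one_pos (fun v w => PeriodisedKernels.isPeriodic₂_lapKer _)]

/-- [folklore] Decay of `A₄` at the rate `dB/4`. -/
theorem decays_A₄ (ha : 0 < a) : ∃ C : ℝ, Decays (comp (comp lapU (Cgh (m + 1) a)) lapU) C (dB (m + 1) a / 4) := by
  obtain ⟨C, hC⟩ := decays_lapU_Cgh (m + 1) a ha
  have hd := dB_pos (m + 1) a ha
  exact ⟨_, decays_comp hC (decays_of_le decays_lapU (by linarith [dB_le_one (m + 1) a])) (by linarith) (by linarith)⟩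

omit [NeZero p] in
/-- [folklore] Joint periodicity of `A₄`. -/
theorem A₄_imageShift (ha : 0 < a) (x y t : Fin 4 → ℤ) (v w : Unit) :
    comp (comp lapU (Cgh (m + 1) a)) lapU (imageShift ((m + 1) * p) x t) (imageShift ((m + 1) * p) y t) v w = comp (comp lapU (Cgh (m + 1) a)) lapU x y v w := by
  refine PeriodicArrays.periodic_of_shiftK (fun t' => ?_) x y t v w
  rw [← ExpKernelCalculus.comp_shiftK, TorusGhostWordArrays.shiftK_lapU, TorusBondArrays.shiftK_lapU_Cgh (m + 1) a ha p t']

/-- [folklore] **W4-M1: `(L̂·perT Cgh) · Ljet₂_b · (L̂ · perT (Cgh ∘ lapU)) = perT (arr (((lapU∘Cgh) ∘ gh₂_β) ∘ A₃))`**. -/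
theorem W4_M1 (ha : 0 < a) :
    Lhat ((m + 1) * p) * perT ((m + 1) * p) (Cgh (m + 1) a) * Ljet₂ ((m + 1) * p) (siteOf 4 ((m + 1) * p) u, κ) * (Lhat ((m + 1) * p) * perT ((m + 1) * p) (comp (Cgh (m + 1) a) lapU))
      = perT ((m + 1) * p) (arr ((m + 1) * p) (comp (comp (comp lapU (Cgh (m + 1) a)) (gh₂ κ u)) (comp lapU (comp (Cgh (m + 1) a) lapU)))) := by
  obtain ⟨C₁, hC₁⟩ := decays_lapU_Cgh (m + 1) a ha
  obtain ⟨C₃, hC₃⟩ := decays_A₃ m ha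
  have hd := dB_pos (m + 1) a ha
  rw [Lhat_mul_perT_Cgh a m p ha, Ljet₂_eq_perT, Lhat_mul_perT_A₂ m p ha,
    perT_mul_perT_arr _ hC₁ (half_pos hd) (lapU_Cgh_imageShift (m + 1) a ha p) (biLoc_gh₂ κ u (dB (m + 1) a / 2)) (half_pos hd),
    perT_arr_mul_perT _ hC₃ (by linarith) (A₃_imageShift m p ha)
      (biLoc_comp_decays hC₁ (biLoc_gh₂ κ u (dB (m + 1) a / 2)) (by linarith : (0:ℝ) ≤ dB (m + 1) a / 4) (by linarith)) (by linarith)]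

/-- [folklore] **W4-M2: `(L̂·perT Cgh·Ljet_b) · Ljet_b′ · (perT Cgh·L̂) = perT (arr ((wR_β ∘ arr s ghCur_β′) ∘ (Cgh∘lapU)))`** (s-dependent). -/
theorem W4_M2 (ha : 0 < a) :
    Lhat ((m + 1) * p) * perT ((m + 1) * p) (Cgh (m + 1) a) * Ljet ((m + 1) * p) (siteOf 4 ((m + 1) * p) u, κ) * Ljet ((m + 1) * p) (siteOf 4 ((m + 1) * p) u', l)
        * (perT ((m + 1) * p) (Cgh (m + 1) a) * Lhat ((m + 1) * p))
      = perT ((m + 1) * p) (arr ((m + 1) * p) (comp (comp (wR (m + 1) a κ u) (arr ((m + 1) * p) (ghCur l u'))) (comp (Cgh (m + 1) a) lapU))) := by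
  obtain ⟨C₂, hC₂⟩ := decays_Cgh_lapU (m + 1) a ha
  obtain ⟨CR, -, hR⟩ := (show ∃ C : ℝ, 0 ≤ C ∧ ∀ (κ : Fin 4) (u : Fin 4 → ℤ), BiLoc (wR (m + 1) a κ u) u u C (dB (m + 1) a / 4) from by
    obtain ⟨C, hC⟩ := decays_lapU_Cgh (m + 1) a ha
    have hd := dB_pos (m + 1) a ha
    exact ⟨_, mul_nonneg (mul_nonneg (Nat.cast_nonneg _) (mul_nonneg (hC.nonneg ()) (Real.exp_pos _).le)) (ExpKernelCalculus.Zl_pos (by linarith)).le,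
      fun κ u => biLoc_comp_decays hC (biLoc_ghCur κ u (dB (m + 1) a / 2)) (by linarith) (by linarith : dB (m + 1) a / 4 < dB (m + 1) a / 2)⟩)
  have hd := dB_pos (m + 1) a ha
  rw [Lhat_Cgh_Ljet m p κ u ha, perT_Cgh_mul_Lhat a m p ha, Ljet_eq_perT,
    perT_arr_mul_perT_arr _ (hR κ u) (by linarith) (biLoc_ghCur l u' (dB (m + 1) a / 4)) (by linarith),
    perT_arr_mul_perT _ hC₂ (half_pos hd) (Cgh_lapU_imageShift (m + 1) a ha p)
      (biLoc_comp_arr _ (hR κ u) (biLoc_ghCur l u' (dB (m + 1) a / 4)) (by linarith)) (by linarith)]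

/-- [folklore] **W4-M4: `(L̂·perT Cgh·L̂) · Ljet₂_b · (perT Cgh·L̂) = perT (arr ((A₄ ∘ gh₂_β) ∘ (Cgh∘lapU)))`**. -/
theorem W4_M4 (ha : 0 < a) :
    Lhat ((m + 1) * p) * perT ((m + 1) * p) (Cgh (m + 1) a) * Lhat ((m + 1) * p) * Ljet₂ ((m + 1) * p) (siteOf 4 ((m + 1) * p) u, κ) * (perT ((m + 1) * p) (Cgh (m + 1) a) * Lhat ((m + 1) * p))
      = perT ((m + 1) * p) (arr ((m + 1) * p) (comp (comp (comp (comp lapU (Cgh (m + 1) a)) lapU) (gh₂ κ u)) (comp (Cgh (m + 1) a) lapU))) := by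
  obtain ⟨C₂, hC₂⟩ := decays_Cgh_lapU (m + 1) a ha
  obtain ⟨C₄, hC₄⟩ := decays_A₄ m ha
  have hd := dB_pos (m + 1) a ha
  rw [Lhat_perT_Cgh_Lhat m p ha, Ljet₂_eq_perT, perT_Cgh_mul_Lhat a m p ha,
    perT_mul_perT_arr _ hC₄ (by linarith) (A₄_imageShift m p ha) (biLoc_gh₂ κ u (dB (m + 1) a / 4)) (by linarith),
    perT_arr_mul_perT _ hC₂ (half_pos hd) (Cgh_lapU_imageShift (m + 1) a ha p)
      (biLoc_comp_decays hC₄ (biLoc_gh₂ κ u (dB (m + 1) a / 4)) (by linarith : (0:ℝ) ≤ dB (m + 1) a / 8) (by linarith)) (by linarith)]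

/-- [folklore] **W4-M5: `(L̂·perT Cgh) · (L̂²)_b · perT Cgh · (L̂²)_b′ · (perT Cgh·L̂) = perT (arr ((((lapU∘Cgh)∘Lgh_β) ∘ Cgh ∘ arr s Lgh_β′) ∘ (Cgh∘lapU)))`**. -/
theorem W4_M5 (ha : 0 < a) :
    Lhat ((m + 1) * p) * perT ((m + 1) * p) (Cgh (m + 1) a)
        * (Ljet ((m + 1) * p) (siteOf 4 ((m + 1) * p) u, κ) * Lhat ((m + 1) * p) + Lhat ((m + 1) * p) * Ljet ((m + 1) * p) (siteOf 4 ((m + 1) * p) u, κ))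
        * perT ((m + 1) * p) (Cgh (m + 1) a)
        * (Ljet ((m + 1) * p) (siteOf 4 ((m + 1) * p) u', l) * Lhat ((m + 1) * p) + Lhat ((m + 1) * p) * Ljet ((m + 1) * p) (siteOf 4 ((m + 1) * p) u', l))
        * (perT ((m + 1) * p) (Cgh (m + 1) a) * Lhat ((m + 1) * p))
      = perT ((m + 1) * p) (arr ((m + 1) * p) (comp (comp (comp (comp (comp lapU (Cgh (m + 1) a)) (Lgh κ u)) (Cgh (m + 1) a)) (arr ((m + 1) * p) (Lgh l u')))
          (comp (Cgh (m + 1) a) lapU))) := by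
  obtain ⟨C₁, hC₁⟩ := decays_lapU_Cgh (m + 1) a ha
  obtain ⟨C₂, hC₂⟩ := decays_Cgh_lapU (m + 1) a ha
  obtain ⟨C, hC⟩ := decays_Cgh_dB m ha
  obtain ⟨C₃, -, hC₃⟩ := TorusWeightWordArrays.biLoc_lapU_Cgh_Lgh m ha
  have hd := dB_pos (m + 1) a ha
  have hX : BiLoc (comp (comp lapU (Cgh (m + 1) a)) (Lgh κ u)) u u C₃ (dB (m + 1) a / 4) := hC₃ κ u
  have hL' : BiLoc (Lgh l u') u' u' cL (dB (m + 1) a / 4) := StepJetData.biLoc_weaken (biLoc_Lgh l u') le_rfl (by linarith [dB_le_one (m + 1) a])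
  have hXA := biLoc_comp_right hX (decays_of_le hC (by linarith : dB (m + 1) a / 4 ≤ dB (m + 1) a / 2)) (by linarith : (0:ℝ) ≤ dB (m + 1) a / 8) (by linarith)
  rw [Lhat_mul_perT_Cgh a m p ha, perT_Cgh_mul_Lhat a m p ha, TorusGhostWordArrays.Lsq_word_eq_perT,
    TorusGhostWordArrays.Lsq_word_eq_perT,
    perT_mul_perT_arr _ hC₁ (half_pos hd) (lapU_Cgh_imageShift (m + 1) a ha p) (biLoc_Lgh κ u) (by norm_num),
    perT_arr_mul_perT _ hC (half_pos hd) (fun x y t v w => KGhostLeg.Cgh_imageShift (m + 1) a ha ⟨p, rfl⟩ x y t v w) hX (by linarith),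
    perT_arr_mul_perT_arr _ hXA (by linarith) hL' (by linarith),
    perT_arr_mul_perT _ hC₂ (half_pos hd) (Cgh_lapU_imageShift (m + 1) a ha p)
      (biLoc_comp_arr _ hXA (StepJetData.biLoc_weaken hL' le_rfl (by linarith)) (by linarith)) (by linarith)]

end Site

end Summit.QuantumFields.BalabanUV.Beta.D1BFx.TorusMixedLetters

end
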